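import Summits.ValiantsHypothesis.ValiantsHypothesis.Theorems.DualUnipotentThreeHalves.Negative.InflatedReturns
import Summits.ValiantsHypothesis.ValiantsHypothesis.Theorems.GrenetZeonDualUnipotentThreeHalvesHeavyTopHalfSpeedCertify
import Literature.LinearAlgebra.Matrix.GerstenhaberNilpotentSubspace

/-!
# LINE β's laws are FALSE: `¬ HalfSpeedIrrLaw` (C⁺ = registered research stub `stub_halfSpeedIrrLaw` of `Lines/half_speed.lean` rev 3)
# and `¬ HalfSpeedLaw` (S⁺) — Negative lane of crux `DualUnipotentThreeHalves`, supports stmt-ValiantsHypothesis-24318 (part 2 of 2)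

val-idea-crit-7 g2 (critic of record; kernel leg of VERDICT #13 under director-valiant RULING R295 (a)/(b)); witness, killing word and
paper proof by val-idea-30 g2 (`Cruxes/DualUnipotentThreeHalves/InflatedReturns.lean`, `HALFSPEED-DEAD.md`); the space `U₄ₖ` and its
nilpotency / irreducibility / dimension are part 1 (`Negative/InflatedReturns.lean`).

KILLING WORD.  For `Q = J₄ ⊗ B + t·(R₂ ⊗ 1) ∈ T` and `P = R₂ ⊗ 1 ∈ U₄ₖ`: `QQP = (E₀₀ − E₁₁) ⊗ B² − t·E₃₀ ⊗ B` (`QQP_eq`) and the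
`0`-th block row of `(QQP)ʲ` is `(B²ʲ, 0, 0, 0)` (`QQP_pow_row`); the word has `#Q = 2j`, `#P = j`, so `HalfSpeed Θ U₄ₖ T` at
`j = Θ + 1` forces `B^{2Θ+2} = 0` (`nilpotent_of_halfSpeed`): the `M_k`-part of `T` is a NILPOTENT subspace, hence (Gerstenhaber,
✓ `Literature…finrank_le_choose_two`) `dim T ≤ k(k−1)/2 + 1` (`finrank_le_of_halfSpeed`) — `codim_{U₄ₖ} T ≥ k(k+1)/2` at EVERY
height.  The law is applied on `Fin 4 × Fin k` through ✓ `exists_certify_leaf_fintype` (val-port-3 g2) at `Θ = 4k = card ι`,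
`k = 8C + 8`: `4k·k(k+1)/2 ≤ C·(4k)²` is absurd (`not_halfSpeedIrrLaw`); `HalfSpeedLaw → HalfSpeedIrrLaw` by dropping the
irreducibility hypothesis (`not_halfSpeedLaw`).
CLASS (critic): refuted-substantive for the FORMAT-FREE fixed-ratio word law of line β (val-idea-30 §(2): freeing the ratio `ρ` does
not rescue the induction — `U_{p,k} ⊕ 𝔫` kills the free-ratio variant); what SURVIVES of β: K0 ✓ `exists_halfSpeed_seam`, the K1
chain ✓ (`…HalfSpeedLoop/Certify/Allocation/Packing/…`) as common-ratio food, and `DenseRatioLaw` (typed law, not a line).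
NOT touched: R2 `HeavyTopLaw`, line α's `FatBlockWeightLaw` (`U₄ₖ`'s tops are weight-thin with the block flag, `(r,c) = (2,1)`),
24318, 8062; `VP ≠ VNP` is NOT proved.  No definitions of record, no named facts.
-/

set_option linter.dupNamespace false
set_option autoImplicit false

open Matrix
open scoped Kronecker BigOperators

namespace Summit.ValiantsHypothesis.ValiantsHypothesis.Theorems.DualUnipotentThreeHalvesNegative.HalfSpeedIrrLawFalse

open Summit.ValiantsHypothesis.ValiantsHypothesis.Theorems.GrenetZeon.HalfSpeed
open Summit.ValiantsHypothesis.ValiantsHypothesis.Theorems.DualUnipotentThreeHalvesNegative.InflatedReturns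

variable (k : ℕ)

/-! ## §4 The killing word `(QQP)ʲ` -/

/-- The word `(Q Q P)ʲ` as a Boolean list (`true ↦ Q`, `false ↦ P`). -/
def killWord : ℕ → List Bool
  | 0 => []
  | j + 1 => true :: true :: false :: killWord j

/-- The killing word uses `Q` exactly `2j` times. -/
lemma count_true_killWord (j : ℕ) : (killWord j).count true = 2 * j := by
  induction j with
  | zero => simp [killWord]
  | succ j ih => simp [killWord, ih]; omega

/-- The killing word uses `P` exactly `j` times. -/
lemma count_false_killWord (j : ℕ) : (killWord j).count false = j := by
  induction j with
  | zero => simp [killWord]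
  | succ j ih => simp [killWord, ih]

/-- The killing word evaluates to `(QQP)ʲ`. -/
lemma gword_killWord (P Q : Matrix (ι k) (ι k) ℂ) (j : ℕ) : gword P Q (killWord j) = (Q * Q * P) ^ j := by
  induction j with
  | zero => simp [killWord, gword]
  | succ j ih =>
      have : gword P Q (killWord (j + 1)) = Q * (Q * (P * gword P Q (killWord j))) := by
        simp [gword, killWord]
      rw [this, ih, pow_succ']
      simp only [Matrix.mul_assoc]

/-- `Q Q P` in closed form for `Q = infl B t`, `P = R₂ ⊗ 1`. -/
lemma QQP_eq (B : Matrix (Fin k) (Fin k) ℂ) (t : ℂ) :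
    infl k B t * infl k B t * (R2 ⊗ₖ (1 : Matrix (Fin k) (Fin k) ℂ)) = D ⊗ₖ (B * B) + (-t) • (E30 ⊗ₖ B) := by
  rw [infl_sq]
  simp only [add_mul, smul_mul_assoc, ← Matrix.mul_kronecker_mul, J4_sq_mul_R2,
    cross_mul_R2', Matrix.smul_kronecker, smul_smul, mul_neg, mul_one]

/-- The `0`-th block row of `(QQP)ʲ` is `(B²ʲ, 0, 0, 0)`. -/
lemma QQP_pow_row (B : Matrix (Fin k) (Fin k) ℂ) (t : ℂ) (j : ℕ) (i : Fin k) (c : Fin 4) (l : Fin k) :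
    ((D ⊗ₖ (B * B) + (-t) • (E30 ⊗ₖ B)) ^ j) (0, i) (c, l) = if c = 0 then (B ^ (2 * j)) i l else 0 := by
  induction j generalizing i c l with
  | zero =>
      fin_cases c <;> simp [Matrix.one_apply, Prod.ext_iff]
  | succ j ih =>
      rw [pow_succ, Matrix.mul_apply]
      have hM : ∀ (m : Fin k) (b : Fin 4), (D ⊗ₖ (B * B) + (-t) • (E30 ⊗ₖ B)) (b, m) (c, l) =
          D b c * (B * B) m l + (-t) * (E30 b c * B m l) := by
        intro m b; simp [Matrix.kroneckerMap_apply, Matrix.add_apply, Matrix.smul_apply]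
      simp only [Fintype.sum_prod_type, ih]
      -- only the block `b = 0` of the row survives
      rw [Fin.sum_univ_four]
      simp only [if_true, if_false, zero_mul, Finset.sum_const_zero,
        add_zero, show (1 : Fin 4) ≠ 0 from by decide, show (2 : Fin 4) ≠ 0 from by decide,
        show (3 : Fin 4) ≠ 0 from by decide]
      simp only [hM]
      fin_cases c
      · simp only [D, E30, Fin.zero_eta, Fin.isValue, of_apply, cons_val', cons_val_zero, empty_val',
          cons_val_fin_one, one_mul, if_true]
        rw [show 2 * (j + 1) = 2 * j + 1 + 1 from by ring, pow_succ, pow_succ, Matrix.mul_assoc, Matrix.mul_apply]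
        simp [Matrix.mul_apply]
      · simp [D, E30]
      · simp [D, E30]
      · simp [D, E30]

/-- **Half speed forces the `M_k`-part of every `Q ∈ T` to be nilpotent.** -/
theorem nilpotent_of_halfSpeed {Θ : ℕ} {T : Set (Matrix (ι k) (ι k) ℂ)}
    (hT : HalfSpeed Θ (inflSpace k : Set (Matrix (ι k) (ι k) ℂ)) T)
    {B : Matrix (Fin k) (Fin k) ℂ} {t : ℂ} (hQ : infl k B t ∈ T) : IsNilpotent B := by
  refine ⟨2 * (Θ + 1), ?_⟩
  have hP : R2 ⊗ₖ (1 : Matrix (Fin k) (Fin k) ℂ) ∈ (inflSpace k : Set (Matrix (ι k) (ι k) ℂ)) := R1_mem k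
  have hcount : ¬ ((killWord (Θ + 1)).count true ≤ Θ + (killWord (Θ + 1)).count false) := by
    rw [count_true_killWord, count_false_killWord]; omega
  have hzero : gword (R2 ⊗ₖ (1 : Matrix (Fin k) (Fin k) ℂ)) (infl k B t) (killWord (Θ + 1)) = 0 := by
    by_contra h
    exact hcount (hT _ hP _ hQ _ h)
  rw [gword_killWord, QQP_eq] at hzero
  ext i l
  have := congrFun (congrFun hzero (0, i)) ((0 : Fin 4), l)
  rw [QQP_pow_row] at this
  simpa using this


/-- Under half speed, `dim T ≤ k(k−1)/2 + 1`. -/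
theorem finrank_le_of_halfSpeed (hk : 1 ≤ k) {Θ : ℕ} (T : Submodule ℂ (Matrix (ι k) (ι k) ℂ))
    (hTU : T ≤ inflSpace k)
    (hT : HalfSpeed Θ (inflSpace k : Set (Matrix (ι k) (ι k) ℂ)) (T : Set (Matrix (ι k) (ι k) ℂ))) :
    Module.finrank ℂ T ≤ k.choose 2 + 1 := by
  classical
  have i₀ : Fin k := ⟨0, hk⟩
  -- the block part restricted to `T`
  let f : T →ₗ[ℂ] Matrix (Fin k) (Fin k) ℂ := (blockPart k).comp T.subtype
  have hnil : ∀ Y ∈ LinearMap.range f, IsNilpotent Y := by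
    rintro Y ⟨⟨Q, hQT⟩, rfl⟩
    obtain ⟨B, t, hQ⟩ := (mem_inflSpace k).1 (hTU hQT)
    have : f ⟨Q, hQT⟩ = B := by simp [f, hQ, blockPart_infl]
    rw [this]
    exact nilpotent_of_halfSpeed k hT (T := (T : Set (Matrix (ι k) (ι k) ℂ))) (by rw [← hQ]; exact hQT)
  have hrange : Module.finrank ℂ (LinearMap.range f) ≤ k.choose 2 :=
    Literature.LinearAlgebra.Matrix.GerstenhaberNilpotentSubspace.finrank_le_choose_two k _ hnil
  -- the kernel of `f` injects into `ℂ` by the scalar part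
  let g : LinearMap.ker f →ₗ[ℂ] ℂ := (scalarPart k i₀).comp ((T.subtype).comp (LinearMap.ker f).subtype)
  have hg : Function.Injective g := by
    intro x y hxy
    obtain ⟨⟨X, hXT⟩, hXker⟩ := x
    obtain ⟨⟨Y, hYT⟩, hYker⟩ := y
    obtain ⟨BX, tX, hX⟩ := (mem_inflSpace k).1 (hTU hXT)
    obtain ⟨BY, tY, hY⟩ := (mem_inflSpace k).1 (hTU hYT)
    have hBX : BX = 0 := by
      have : f ⟨X, hXT⟩ = 0 := hXker
      simpa [f, hX, blockPart_infl] using this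
    have hBY : BY = 0 := by
      have : f ⟨Y, hYT⟩ = 0 := hYker
      simpa [f, hY, blockPart_infl] using this
    have ht : tX = tY := by simpa [g, hX, hY, scalarPart_infl] using hxy
    apply Subtype.ext; apply Subtype.ext
    simp only
    rw [hX, hY, hBX, hBY, ht]
  have hker : Module.finrank ℂ (LinearMap.ker f) ≤ 1 := by
    have := LinearMap.finrank_le_finrank_of_injective hg
    simpa using this
  have hsum := LinearMap.finrank_range_add_finrank_ker f
  omega

/-! ## §6 The refutations -/

/-- **C⁺ is false**: `¬ HalfSpeedIrrLaw`. -/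
theorem not_halfSpeedIrrLaw : ¬ HalfSpeedIrrLaw := by
  intro hC
  obtain ⟨C, hC⟩ := exists_certify_leaf_fintype hC
  -- the format: `k = 8C + 8`, `ι = Fin 4 × Fin k`, `Θ = 4k = card ι`
  set k : ℕ := 8 * C + 8 with hkdef
  have hk : 1 ≤ k := by omega
  have hcard : Fintype.card (ι k) = 4 * k := by simp [ι, Fintype.card_prod]
  obtain ⟨T, hTU, hcodim, hT⟩ := hC (ι := ι k) (inflSpace k) (inflSpace_nilpotent k)
    (inflSpace_irreducible k) (4 * k) (by omega) (by rw [hcard])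
  rw [hcard, finrank_inflSpace k hk] at hcodim
  have hT' := finrank_le_of_halfSpeed k hk T hTU hT
  have hchoose : 2 * k.choose 2 ≤ k * k := by
    rw [Nat.choose_two_right]
    have := Nat.div_mul_le_self (k * (k - 1)) 2
    have h2 : k * (k - 1) ≤ k * k := Nat.mul_le_mul_left k (Nat.sub_le k 1)
    omega
  -- `4k · (k² + 1 − dim T) ≤ 16 C k²` with `dim T ≤ k(k−1)/2 + 1` is absurd for `k = 8C + 8`
  have h1 : k * k + 1 - Module.finrank ℂ T ≥ k * k - k.choose 2 := by omega
  have h2 : 4 * k * (k * k - k.choose 2) ≤ C * (4 * k) ^ 2 :=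
    le_trans (Nat.mul_le_mul_left _ h1) hcodim
  have h3 : 2 * (k * k - k.choose 2) ≥ k * k := by omega
  nlinarith [h2, h3, hk]

/-- S⁺ implies C⁺ (C⁺ has more hypotheses). -/
theorem halfSpeedIrrLaw_of_halfSpeedLaw (h : HalfSpeedLaw) : HalfSpeedIrrLaw := by
  obtain ⟨C, hC⟩ := h
  exact ⟨C, fun d U hU _ Θ h1 h2 => hC d U hU Θ h1 h2⟩

/-- **S⁺ is false**: `¬ HalfSpeedLaw`. -/
theorem not_halfSpeedLaw : ¬ HalfSpeedLaw := fun h => not_halfSpeedIrrLaw (halfSpeedIrrLaw_of_halfSpeedLaw h)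

end Summit.ValiantsHypothesis.ValiantsHypothesis.Theorems.DualUnipotentThreeHalvesNegative.HalfSpeedIrrLawFalse

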